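import Literature.MathematicalPhysics.QuantumFieldTheory.Balaban1983to89.B13OpsYPencilGreenPrime
import Literature.MathematicalPhysics.QuantumFieldTheory.Balaban1983to89.Node00.OpsYRecordV4

/-!
# `Balaban1983to89.B13OpsYPencilGreenPrimeSym` — T. Bałaban, *Propagators for lattice gauge theories in a background field*, Commun. Math. Phys. **99** (1985)
# 389–434 [Balaban1985BackgroundPropagators], (3.19) p. 393, (3.21) and (3.24)–(3.25) p. 394 (`Q′(U)`, `Δ′_a(U)`, «Its inverse is denoted by G′»), (3.40) p. 397
# (the taxicab contour transporter `U(Γ_{z,w})` and its reversal), Thm 3.1 (3.42) p. 397, Thm 3.4 and (3.50) p. 400 («the operators … extend to configurations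
# U′U … as analytic functions of A′»), Sect. B (3.60)–(3.65) p. 402, Thm 3.10 (3.107)–(3.108) p. 416; [Balaban1988RG2Cluster] (2.5)–(2.7) pp. 12–13, p. 15:
# THE G′-JUNCTION AT THE v4 LETTER OF RECORD — `Δ′_a(U)` AND `G′(U) = Δ′_a(U)⁻¹` AT NODE 00's SYMMETRISED SITE TRANSPORTER `parSymY` ALONG pv27's PENCIL.

statement-level complex analysis ([folklore]) AT NODE 00's `rfl`-level definitions (`parSymY avgTrY deltaPrimeAY GpY`), over the lane's modules 72 ∕ 74
(`B13OpsYPencilTransport`, `B13OpsYPencilDeltaPrime`) and width seat n10-w2's `B13OpsYPencilGreenPrime` ∕ `B13InverseOperatorCoordinates`; kernel-checked;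
THEOREMS ONLY (no `def`, no `structure`, no instance, no notation); NOTHING of NODE 00's ∕ pv27's is modified; nothing here is a claim about the Yang–Mills
mass gap; no node is discharged; count-neutral.

WHY THIS FILE (cell `pub-ymgap`, HUMAN RULING D-0062 ∕ D-0149, Track A node N10 = [B13]; seat `pub-ymgap-dag-n10-c` g15, INTENT-3 = module 78).  A CURRENCY FORK ON
THE SITE TRANSPORTER: module 74 and n10-w2's G′-junction (`B13OpsYPencilGreenPrime` §3–§4) read `Δ′_a(U)` ∕ `G′(U)` at def-Y's v2 letter `parSY` (the taxicab
contour, `Node00.covLettersY_v2_Gp`), whereas N06's record face is the v4 letter `parSymY` (`Node00/OpsYRecordV4`: `U(Γ_{z,w}) = parSY z w` for `z ≤ w`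
lexicographically, `(parSY w z)⁻¹` otherwise — print's tacit convention for reversed contours), at which N06's Theorem 3.1 IS a tree theorem (dag-n06-w1's
`B9Thm31SiteGpKernelTorusDecayReg335Y.hs_GpY_deltaY_le_torus`, dag-n06-j's `B9Thm311DeltaPrimePos.isUnit_deltaPrimeAY_parSymY`).  THIS FILE re-keys the
pencil reading of `Δ′_a` and the G′-junction at `parSymY`, with the SAME majorants (the reversed contour has the same length): §1 the symmetrised transporter
along the pencil, §2 the averaging transporter through the block corner at `parSymY`, §3 `Δ′_a(U)` at `parSymY` along the pencil (holomorphic, coordinates,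
bound — 74 §4 verbatim), §4 the square `RawEntryLetters` packaging (GreenPrime §3 verbatim; its locality ∕ range lemmas are generic in the transporter letter),
§5 the G′-junction at `parSymY` modulo the two centre inputs (GreenPrime §4 verbatim).  The companion module 79 (`B13GreenPrimeSymLettersOfReg335`) discharges
the two centre inputs from N06's theorems on the (3.35) class at `𝔸 = M_N(ℂ)`.

WHAT THIS FILE PROVES (all `theorem`s; `𝔸` NODE 00's complete normed `ℂ`-algebra, `‖1‖ = 1` where bounds are taken).
* §1 `differentiableOn_parSymY_prodCfg`, `differentiableOn_parSymY_inv_prodCfg`, `norm_parSymY_prodCfg_le`, `norm_parSymY_inv_prodCfg_le` (`≤ Kη^{Site.tdist}`).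
* §2 `differentiableOn_avgTrY_parSymY_prodCfg`, `differentiableOn_avgTrY_parSymY_inv_prodCfg`, `norm_avgTrY_parSymY_prodCfg_le`, `norm_avgTrY_parSymY_inv_prodCfg_le`.
* §3 ★★ `differentiableOn_deltaPrimeAY_parSymY_prodCfg`, `differentiableOn_coord_deltaPrimeAY_parSymY_prodCfg`, `norm_deltaPrimeAY_parSymY_prodCfg_le`.
* §4 ★★ `rawEntryLetters_toMatrix_deltaPrimeAY_parSymY_prodCfg`.
* §5 ★★★ `rawEntryLetters_toMatrix_GpY_parSymY_prodCfg_of_pencil` — `RawEntryLetters (A′ ↦ toMatrix B′ B′ (G′(e^{iηA′}U₀))) (ℓ ∘ fst) R₁⋆ ρ′ (2·cb·cl·B_G)` at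
  `G′ = GpY i (parSymY i)`, displaying `IsUnit (Δ′_a(U₀))` and the pointwise (3.108)-type bound of `G′(U₀)` at the ONE real background.
HONEST FRAMING: readers + located numerals; the centre inputs stay displayed here (module 79 discharges them on the (3.35) class); which of v2 `parSY` ∕ v4
`parSymY`, which `ℓ`, `b`, `U₀`, `η` are «of record» for the N10 term is NODE 00's ∕ def-Y's ∕ def-T's word; nothing of Bałaban's asserted; N06 ∕ N10 NOT
discharged; K1⁷ NOT closed; counts unmoved (typed 28∕28 · discharged 5∕27); 0 `def`, 0 `sorry`, standard axioms; one finite 𝕋⁴ programme at fixed ε —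
R4 closes the conditional finite-𝕋⁴ rung `BalabanLadder.UV` only; the YM mass gap (Clay) is NOT proved by any of this; nothing continuum ∕ ℝ⁴ ∕ OS.

References: T. Bałaban, CMP 99 (1985) 389–434 [Balaban1985BackgroundPropagators] (3.5) p.391, (3.19) p.393, (3.21), (3.24)–(3.25) p.394, (3.40) p.397, (3.35)–(3.37)
p.396, Thm 3.1 (3.42) p.397, Thm 3.4 and (3.50) p.400, (3.60)–(3.65) p.402, Thm 3.10 (3.107)–(3.108) pp.415–416; CMP 116 (1988) 1–22 [Balaban1988RG2Cluster]
(2.5)–(2.7) pp.12–13, p.15; CMP 96 (1984) 223–250 [Balaban1984PropagatorsII] Lemma 2.1 (2.61) p.234.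
-/

noncomputable section

namespace Literature.MathematicalPhysics.QuantumFieldTheory.Balaban1983to89.B13OpsYPencilGreenPrimeSym

open Metric Set Finset Module
open scoped Matrix
open Literature.MathematicalPhysics.QuantumFieldTheory.Balaban1983to89
open Literature.MathematicalPhysics.QuantumFieldTheory.Balaban1983to89.B9Thm37GlueTorus (tdist1)
open Literature.MathematicalPhysics.QuantumFieldTheory.Balaban1983to89.B5TorusCover (UT)
open Literature.MathematicalPhysics.QuantumFieldTheory.Balaban1983to89.B13EntrywiseWalks (RawEntryLetters)
open Literature.MathematicalPhysics.QuantumFieldTheory.Balaban1983to89.B13AccretiveOfRealCoercive (rawEntryLetters_of_range_family)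
open Literature.MathematicalPhysics.QuantumFieldTheory.Balaban1983to89.B13InverseOperatorCoordinates
  (rawEntryLetters_toMatrix_of_coordFamily rawEntryLetters_toMatrix_ringInverse_located_of_kernelBound)
open Literature.MathematicalPhysics.QuantumFieldTheory.Balaban1983to89.B13OpsYPencilGreenPrime (tdist_le_of_deltaPrimeAY_single_ne_zero)
open Literature.MathematicalPhysics.QuantumFieldTheory.Balaban1983to89.B13OpsYPencilDeltaPrime
  (val_avgTrY val_inv_avgTrY differentiableOn_lapS_prodCfg norm_lapS_prodCfg_le)
open Literature.MathematicalPhysics.QuantumFieldTheory.Balaban1983to89.B13OpsYPencilTransport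
  (differentiableOn_parSY_prodCfg differentiableOn_parSY_inv_prodCfg norm_parSY_prodCfg_le norm_parSY_inv_prodCfg_le)
open Literature.MathematicalPhysics.QuantumFieldTheory.Balaban1983to89.B9Eq39Adjoint (R R_def prodCfg)
open Literature.MathematicalPhysics.QuantumFieldTheory.Balaban1983to89.B9Eq369Product (prodCfg_zero)
open Literature.MathematicalPhysics.QuantumFieldTheory.Balaban1983to89.B6GlobalChartV1 (PV boxEquiv)
open Literature.MathematicalPhysics.QuantumFieldTheory.Balaban1983to89.B6KLevelCensusIndexV1 (KIdx)
open Literature.MathematicalPhysics.QuantumFieldTheory.Balaban1983to89.Node00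
  (SiteY CfgY shiftY cornerY levY avgCoeffY avgTrY deltaPrimeAY deltaPrimeAY_apply GpY parSY parSymY parSymY_of_le parSymY_of_not_le deltaPrimeAY_mul_GpY)

variable {𝔸 : Type} [NormedRing 𝔸] [NormedAlgebra ℂ 𝔸] [CompleteSpace 𝔸]
variable {d ℓ : ℕ} {hd : 1 ≤ d + 1} {hL : Odd (ℓ + 1) ∧ 1 < ℓ + 1} {b₀ b₁ : ℝ}
variable (i : KIdx d ℓ hd hL b₀ b₁) (U₀ : CfgY 𝔸 i) (η : ℝ) {Rc K₀ : ℝ}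

/-- kernel: the `ℓ¹` torus distance is symmetric. [folklore] -/
private theorem tdist_comm' {j : ℕ} (x y : Site (PV d ℓ i.m i.K hd hL) j) : Site.tdist x y = Site.tdist y x := by
  unfold Site.tdist
  exact Finset.sum_congr rfl fun μ _ => min_comm _ _

/-! ## §1. The symmetrised site transporter `parSymY` along the pencil -/

section Transporter

/-- `A′ ↦ U(Γ_{z,z′})` at the v4 letter `parSymY` and `U = e^{iηA′}U₀` is holomorphic on every ball (either branch of the lexicographic case split is a 72 fact).
[cite: Balaban1985BackgroundPropagators, (3.40) p.397, (3.21) p.394, Thm 3.4 p.400] -/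
theorem differentiableOn_parSymY_prodCfg (z z' : SiteY i) :
    DifferentiableOn ℂ (fun a => (parSymY i (prodCfg U₀ η a) z z' : 𝔸)) (ball (0 : Fin (d + 1) → Site (PV d ℓ i.m i.K hd hL) 0 → 𝔸) Rc) := by
  by_cases h : toLex z.1 ≤ toLex z'.1
  · simp only [parSymY_of_le h]; exact differentiableOn_parSY_prodCfg i U₀ η z z'
  · simp only [parSymY_of_not_le h]; exact differentiableOn_parSY_inv_prodCfg i U₀ η z' z

/-- … and so is its inverse. [cite: Balaban1985BackgroundPropagators, (3.40) p.397, (3.5) p.391, Thm 3.4 p.400] -/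
theorem differentiableOn_parSymY_inv_prodCfg (z z' : SiteY i) :
    DifferentiableOn ℂ (fun a => (((parSymY i (prodCfg U₀ η a) z z')⁻¹ : 𝔸ˣ) : 𝔸))
      (ball (0 : Fin (d + 1) → Site (PV d ℓ i.m i.K hd hL) 0 → 𝔸) Rc) := by
  by_cases h : toLex z.1 ≤ toLex z'.1
  · simp only [parSymY_of_le h]; exact differentiableOn_parSY_inv_prodCfg i U₀ η z z'
  · simp only [parSymY_of_not_le h, inv_inv]; exact differentiableOn_parSY_prodCfg i U₀ η z' z

variable [NormOneClass 𝔸]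

/-- On `‖A′‖ < R`: `‖parSymY i (e^{iηA′}U₀) z z′‖ ≤ Kη^{Site.tdist (chart⁻¹ z) (chart⁻¹ z′)}` (the reversed contour has the same length).
[cite: Balaban1985BackgroundPropagators, (3.40) p.397, (3.35)–(3.37) p.396] -/
theorem norm_parSymY_prodCfg_le (hU : ∀ μ x, ‖(U₀ μ x : 𝔸)‖ ≤ K₀) (hUi : ∀ μ x, ‖(((U₀ μ x)⁻¹ : 𝔸ˣ) : 𝔸)‖ ≤ K₀) (hRc : 0 ≤ Rc)
    {a : Fin (d + 1) → Site (PV d ℓ i.m i.K hd hL) 0 → 𝔸} (ha : a ∈ ball 0 Rc) (z z' : SiteY i) :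
    ‖(parSymY i (prodCfg U₀ η a) z z' : 𝔸)‖ ≤ (K₀ * Real.exp (|η| * Rc)) ^ Site.tdist ((boxEquiv i.hN).symm z) ((boxEquiv i.hN).symm z') := by
  by_cases h : toLex z.1 ≤ toLex z'.1
  · rw [parSymY_of_le h]; exact norm_parSY_prodCfg_le i U₀ η hU hUi hRc ha z z'
  · rw [parSymY_of_not_le h, tdist_comm']; exact norm_parSY_inv_prodCfg_le i U₀ η hU hUi hRc ha z' z

/-- On `‖A′‖ < R`: `‖(parSymY i (e^{iηA′}U₀) z z′)⁻¹‖ ≤ Kη^{Site.tdist (chart⁻¹ z) (chart⁻¹ z′)}`. [cite: Balaban1985BackgroundPropagators, (3.40) p.397, (3.5) p.391, (3.35)–(3.37) p.396] -/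
theorem norm_parSymY_inv_prodCfg_le (hU : ∀ μ x, ‖(U₀ μ x : 𝔸)‖ ≤ K₀) (hUi : ∀ μ x, ‖(((U₀ μ x)⁻¹ : 𝔸ˣ) : 𝔸)‖ ≤ K₀) (hRc : 0 ≤ Rc)
    {a : Fin (d + 1) → Site (PV d ℓ i.m i.K hd hL) 0 → 𝔸} (ha : a ∈ ball 0 Rc) (z z' : SiteY i) :
    ‖(((parSymY i (prodCfg U₀ η a) z z')⁻¹ : 𝔸ˣ) : 𝔸)‖ ≤
      (K₀ * Real.exp (|η| * Rc)) ^ Site.tdist ((boxEquiv i.hN).symm z) ((boxEquiv i.hN).symm z') := by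
  by_cases h : toLex z.1 ≤ toLex z'.1
  · rw [parSymY_of_le h]; exact norm_parSY_inv_prodCfg_le i U₀ η hU hUi hRc ha z z'
  · rw [parSymY_of_not_le h, inv_inv, tdist_comm']; exact norm_parSY_prodCfg_le i U₀ η hU hUi hRc ha z' z

end Transporter

/-! ## §2. The averaging transporter through the block corner, at `parSymY`, along the pencil -/

section AvgTransport

/-- `A′ ↦ avgTrY parSymY (e^{iηA′}U₀) z w` is holomorphic on every ball. [cite: Balaban1985BackgroundPropagators, (3.19) p.393, (3.24) p.394, Thm 3.4 p.400] -/
theorem differentiableOn_avgTrY_parSymY_prodCfg (z w : SiteY i) :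
    DifferentiableOn ℂ (fun a => (avgTrY i (parSymY i) (prodCfg U₀ η a) z w : 𝔸)) (ball (0 : Fin (d + 1) → Site (PV d ℓ i.m i.K hd hL) 0 → 𝔸) Rc) := by
  simp only [val_avgTrY]
  exact (differentiableOn_parSymY_prodCfg i U₀ η z _).mul (differentiableOn_parSymY_prodCfg i U₀ η _ w)

/-- … and so is its inverse. [cite: Balaban1985BackgroundPropagators, (3.19) p.393, (3.5) p.391, Thm 3.4 p.400] -/
theorem differentiableOn_avgTrY_parSymY_inv_prodCfg (z w : SiteY i) :
    DifferentiableOn ℂ (fun a => (((avgTrY i (parSymY i) (prodCfg U₀ η a) z w)⁻¹ : 𝔸ˣ) : 𝔸))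
      (ball (0 : Fin (d + 1) → Site (PV d ℓ i.m i.K hd hL) 0 → 𝔸) Rc) := by
  simp only [val_inv_avgTrY]
  exact (differentiableOn_parSymY_inv_prodCfg i U₀ η _ w).mul (differentiableOn_parSymY_inv_prodCfg i U₀ η z _)

variable [NormOneClass 𝔸]

/-- On `‖A′‖ < R`: `‖avgTrY parSymY (e^{iηA′}U₀) z w‖ ≤ Kη^{ℓ₁} · Kη^{ℓ₂}`, `ℓ₁, ℓ₂` the taxicab lengths `z → c`, `c → w` (through the box chart).
[cite: Balaban1985BackgroundPropagators, (3.19) p.393, (3.40) p.397, (3.35)–(3.37) p.396] -/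
theorem norm_avgTrY_parSymY_prodCfg_le (hU : ∀ μ x, ‖(U₀ μ x : 𝔸)‖ ≤ K₀) (hUi : ∀ μ x, ‖(((U₀ μ x)⁻¹ : 𝔸ˣ) : 𝔸)‖ ≤ K₀) (hRc : 0 ≤ Rc)
    {a : Fin (d + 1) → Site (PV d ℓ i.m i.K hd hL) 0 → 𝔸} (ha : a ∈ ball 0 Rc) (z w : SiteY i) :
    ‖(avgTrY i (parSymY i) (prodCfg U₀ η a) z w : 𝔸)‖ ≤
      (K₀ * Real.exp (|η| * Rc)) ^ Site.tdist ((boxEquiv i.hN).symm z) ((boxEquiv i.hN).symm (cornerY i (levY i z) z)) *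
        (K₀ * Real.exp (|η| * Rc)) ^ Site.tdist ((boxEquiv i.hN).symm (cornerY i (levY i z) z)) ((boxEquiv i.hN).symm w) := by
  rw [val_avgTrY]
  have h1 := norm_parSymY_prodCfg_le i U₀ η hU hUi hRc ha z (cornerY i (levY i z) z)
  have h2 := norm_parSymY_prodCfg_le i U₀ η hU hUi hRc ha (cornerY i (levY i z) z) w
  exact (norm_mul_le _ _).trans (mul_le_mul h1 h2 (norm_nonneg _) ((norm_nonneg _).trans h1))

/-- On `‖A′‖ < R`: `‖(avgTrY parSymY (e^{iηA′}U₀) z w)⁻¹‖ ≤ Kη^{ℓ₂} · Kη^{ℓ₁}`. [cite: Balaban1985BackgroundPropagators, (3.19) p.393, (3.5) p.391, (3.40) p.397] -/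
theorem norm_avgTrY_parSymY_inv_prodCfg_le (hU : ∀ μ x, ‖(U₀ μ x : 𝔸)‖ ≤ K₀) (hUi : ∀ μ x, ‖(((U₀ μ x)⁻¹ : 𝔸ˣ) : 𝔸)‖ ≤ K₀) (hRc : 0 ≤ Rc)
    {a : Fin (d + 1) → Site (PV d ℓ i.m i.K hd hL) 0 → 𝔸} (ha : a ∈ ball 0 Rc) (z w : SiteY i) :
    ‖(((avgTrY i (parSymY i) (prodCfg U₀ η a) z w)⁻¹ : 𝔸ˣ) : 𝔸)‖ ≤
      (K₀ * Real.exp (|η| * Rc)) ^ Site.tdist ((boxEquiv i.hN).symm (cornerY i (levY i z) z)) ((boxEquiv i.hN).symm w) *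
        (K₀ * Real.exp (|η| * Rc)) ^ Site.tdist ((boxEquiv i.hN).symm z) ((boxEquiv i.hN).symm (cornerY i (levY i z) z)) := by
  rw [val_inv_avgTrY]
  have h1 := norm_parSymY_inv_prodCfg_le i U₀ η hU hUi hRc ha (cornerY i (levY i z) z) w
  have h2 := norm_parSymY_inv_prodCfg_le i U₀ η hU hUi hRc ha z (cornerY i (levY i z) z)
  exact (norm_mul_le _ _).trans (mul_le_mul h1 h2 (norm_nonneg _) ((norm_nonneg _).trans h1))

end AvgTransport

/-! ## §3. ★★ `Δ′_a(U)` (3.24) at `parSymY` along the pencil -/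

section DeltaPrime

/-- ★★ **`A′ ↦ (Δ′_a(e^{iηA′}U₀)Λ)(z)` AT THE v4 LETTER IS HOLOMORPHIC** on every chart ball, for every field `Λ` and site `z`
(`deltaPrimeAY i (parSymY i)`; 74 §4 re-keyed). [cite: Balaban1985BackgroundPropagators, (3.24) p.394, Thm 3.4 p.400, (3.62)–(3.64) p.402] -/
theorem differentiableOn_deltaPrimeAY_parSymY_prodCfg (Λ : SiteY i → 𝔸) (z : SiteY i) :
    DifferentiableOn ℂ (fun a => deltaPrimeAY i (parSymY i) (prodCfg U₀ η a) Λ z) (ball (0 : Fin (d + 1) → Site (PV d ℓ i.m i.K hd hL) 0 → 𝔸) Rc) := by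
  simp only [deltaPrimeAY_apply, R_def]
  refine (differentiableOn_lapS_prodCfg i U₀ η Λ z).add (DifferentiableOn.fun_sum fun w _ => ?_)
  exact (((differentiableOn_avgTrY_parSymY_prodCfg i U₀ η z w).mul (differentiableOn_const _)).mul
    (differentiableOn_avgTrY_parSymY_inv_prodCfg i U₀ η z w)).const_smul (((avgCoeffY i z w : ℝ) : ℂ))

/-- ★ **THE N10 COORDINATES OF `Δ′_a` AT THE v4 LETTER ALONG THE PENCIL ARE HOLOMORPHIC**: `A′ ↦ φ_k((Δ′_a(e^{iηA′}U₀)(δ_x ⊗ e_l))(z))`.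
[cite: Balaban1985BackgroundPropagators, (3.24) p.394, Thm 3.4 p.400; Balaban1988RG2Cluster, (2.5) p.12, p.15] -/
theorem differentiableOn_coord_deltaPrimeAY_parSymY_prodCfg [DecidableEq (SiteY i)] {κ : Type} (φ : κ → 𝔸 →L[ℂ] ℂ) (e : κ → 𝔸) (z x : SiteY i) (k l : κ) :
    DifferentiableOn ℂ (fun a => φ k (deltaPrimeAY i (parSymY i) (prodCfg U₀ η a) (Pi.single x (e l)) z))
      (ball (0 : Fin (d + 1) → Site (PV d ℓ i.m i.K hd hL) 0 → 𝔸) Rc) :=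
  (φ k).differentiable.comp_differentiableOn (differentiableOn_deltaPrimeAY_parSymY_prodCfg i U₀ η (Pi.single x (e l)) z)

variable [NormOneClass 𝔸] {D : ℕ}

/-- ★★ **… WITH THE BOUND** on `‖A′‖ < R` (74's majorant verbatim): `‖(Δ′_a(e^{iηA′}U₀)Λ)(z)‖ ≤ [Laplacian majorant] + (Σ_w |avgCoeff(z,w)|)·(Kη^D·‖Λ‖·Kη^D)`,
given `‖U₀(b)^{±1}‖ ≤ K₀`, `1 ≤ K₀` and the support-length numeral `D`. [cite: Balaban1985BackgroundPropagators, (3.24) p.394, (3.40) p.397, Thm 3.4 p.400, (3.108) p.416] -/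
theorem norm_deltaPrimeAY_parSymY_prodCfg_le (hU : ∀ μ x, ‖(U₀ μ x : 𝔸)‖ ≤ K₀) (hUi : ∀ μ x, ‖(((U₀ μ x)⁻¹ : 𝔸ˣ) : 𝔸)‖ ≤ K₀) (hK1 : 1 ≤ K₀)
    (hRc : 0 ≤ Rc)
    (hD : ∀ z w, avgCoeffY i z w ≠ 0 →
      Site.tdist ((boxEquiv i.hN).symm z) ((boxEquiv i.hN).symm (cornerY i (levY i z) z)) +
        Site.tdist ((boxEquiv i.hN).symm (cornerY i (levY i z) z)) ((boxEquiv i.hN).symm w) ≤ D)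
    (Λ : SiteY i → 𝔸) {a : Fin (d + 1) → Site (PV d ℓ i.m i.K hd hL) 0 → 𝔸} (ha : a ∈ ball 0 Rc) (z : SiteY i) :
    ‖deltaPrimeAY i (parSymY i) (prodCfg U₀ η a) Λ z‖ ≤
      ((d : ℝ) + 1) *
        (K₀ * Real.exp (|η| * Rc) * (K₀ * Real.exp (|η| * Rc) * ‖Λ‖ * (K₀ * Real.exp (|η| * Rc)) + ‖Λ‖) * (K₀ * Real.exp (|η| * Rc)) +
          (K₀ * Real.exp (|η| * Rc) * ‖Λ‖ * (K₀ * Real.exp (|η| * Rc)) + ‖Λ‖)) +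
      (∑ w, |avgCoeffY i z w|) * ((K₀ * Real.exp (|η| * Rc)) ^ D * ‖Λ‖ * (K₀ * Real.exp (|η| * Rc)) ^ D) := by
  -- adapted from `B13OpsYPencilDeltaPrime.norm_deltaPrimeAY_prodCfg_le` (module 74), `parSY` ↦ `parSymY`
  set Kη : ℝ := K₀ * Real.exp (|η| * Rc) with hKη
  have h1 : (1 : ℝ) ≤ Kη := one_le_mul_of_one_le_of_one_le hK1 (Real.one_le_exp (mul_nonneg (abs_nonneg _) hRc))
  have h0 : (0 : ℝ) ≤ Kη := zero_le_one.trans h1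
  rw [deltaPrimeAY_apply]
  refine (norm_add_le _ _).trans (add_le_add (norm_lapS_prodCfg_le i U₀ η hU hUi hRc Λ ha z) ?_)
  rw [Finset.sum_mul]
  refine (norm_sum_le _ _).trans (Finset.sum_le_sum fun w _ => ?_)
  rw [norm_smul, Complex.norm_real, Real.norm_eq_abs]
  by_cases hc : avgCoeffY i z w = 0
  · rw [hc, abs_zero, zero_mul, zero_mul]
  refine mul_le_mul_of_nonneg_left ?_ (abs_nonneg _)
  rw [R_def]
  have hsum := hD z w hc
  have hV : ‖(avgTrY i (parSymY i) (prodCfg U₀ η a) z w : 𝔸)‖ ≤ Kη ^ D := by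
    refine (norm_avgTrY_parSymY_prodCfg_le i U₀ η hU hUi hRc ha z w).trans ?_
    rw [← pow_add]
    exact pow_le_pow_right₀ h1 hsum
  have hVi : ‖(((avgTrY i (parSymY i) (prodCfg U₀ η a) z w)⁻¹ : 𝔸ˣ) : 𝔸)‖ ≤ Kη ^ D := by
    refine (norm_avgTrY_parSymY_inv_prodCfg_le i U₀ η hU hUi hRc ha z w).trans ?_
    rw [← pow_add, add_comm]
    exact pow_le_pow_right₀ h1 hsum
  calc ‖(avgTrY i (parSymY i) (prodCfg U₀ η a) z w : 𝔸) * Λ w * (((avgTrY i (parSymY i) (prodCfg U₀ η a) z w)⁻¹ : 𝔸ˣ) : 𝔸)‖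
      ≤ ‖(avgTrY i (parSymY i) (prodCfg U₀ η a) z w : 𝔸) * Λ w‖ * ‖(((avgTrY i (parSymY i) (prodCfg U₀ η a) z w)⁻¹ : 𝔸ˣ) : 𝔸)‖ :=
        norm_mul_le _ _
    _ ≤ Kη ^ D * ‖Λ‖ * Kη ^ D :=
        mul_le_mul ((norm_mul_le _ _).trans (mul_le_mul hV (norm_le_pi_norm Λ w) (norm_nonneg _) (pow_nonneg h0 D))) hVi
          (norm_nonneg _) (mul_nonneg (pow_nonneg h0 D) (norm_nonneg _))

end DeltaPrime

/-! ## §4. ★★ The square `RawEntryLetters` packaging of `A′ ↦ toMatrix B′ B′ (Δ′_a(e^{iηA′}U₀))` at `parSymY` -/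

section Packaging

variable [NormOneClass 𝔸] [DecidableEq (SiteY i)]
variable {ν : ℕ} {Nf : Fin ν → ℕ} [∀ j, NeZero (Nf j)]
variable {κ : Type} [Fintype κ] [DecidableEq κ] (b : Basis κ ℂ 𝔸)
variable {D : ℕ}

/-- ★★ **`Δ′_a` AT THE v4 LETTER ALONG THE PENCIL AS AN N10 LETTER DATUM** (GreenPrime §3 re-keyed at `parSymY`; same constant): for EVERY `ρ ≥ 0`,
`RawEntryLetters (A′ ↦ toMatrix B′ B′ (Δ′_a(e^{iηA′}U₀))) (ℓ ∘ fst) Rc ρ (cb·M·e^{ρs})`.  Inputs: the background's size, `0 ≤ Rc`, the averaging support-length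
numeral `D` and row sum `Cavg ≥ 0`, the basis numerals `cb, cl ≥ 0`, the reading numerals of GreenPrime §2 (one lattice step ∕ a non-zero averaging
coefficient read as `ℓ`-distance `≤ s`). [cite: Balaban1985BackgroundPropagators, (3.24) p.394, Thm 3.4 and (3.50) p.400, Thm 3.10 (3.107)–(3.108) p.416; Balaban1988RG2Cluster, (2.5) p.12, p.15] -/
theorem rawEntryLetters_toMatrix_deltaPrimeAY_parSymY_prodCfg
    (hU : ∀ μ x, ‖(U₀ μ x : 𝔸)‖ ≤ K₀) (hUi : ∀ μ x, ‖(((U₀ μ x)⁻¹ : 𝔸ˣ) : 𝔸)‖ ≤ K₀) (hK1 : 1 ≤ K₀) (hRc : 0 ≤ Rc)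
    (hD : ∀ z w, avgCoeffY i z w ≠ 0 →
      Site.tdist ((boxEquiv i.hN).symm z) ((boxEquiv i.hN).symm (cornerY i (levY i z) z)) +
        Site.tdist ((boxEquiv i.hN).symm (cornerY i (levY i z) z)) ((boxEquiv i.hN).symm w) ≤ D)
    {Cavg : ℝ} (hCavg0 : 0 ≤ Cavg) (hCavg : ∀ z, ∑ w, |avgCoeffY i z w| ≤ Cavg)
    {cb cl : ℝ} (hcb : ∀ (a : 𝔸) (k : κ), ‖b.repr a k‖ ≤ cb * ‖a‖) (hcb0 : 0 ≤ cb) (hcl : ∀ l, ‖b l‖ ≤ cl) (hcl0 : 0 ≤ cl)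
    (ℓ' : SiteY i → UT Nf) {s : ℝ} (hs0 : 0 ≤ s)
    (hℓ : ∀ μ z, tdist1 Nf (ℓ' (shiftY i μ z)) (ℓ' z) ≤ s) (hℓa : ∀ z w, avgCoeffY i z w ≠ 0 → tdist1 Nf (ℓ' z) (ℓ' w) ≤ s)
    {ρ : ℝ} (hρ : 0 ≤ ρ) :
    RawEntryLetters (fun a : Fin (d + 1) → Site (PV d ℓ i.m i.K hd hL) 0 → 𝔸 =>
        LinearMap.toMatrix ((Pi.basis fun _ : SiteY i => b).reindex (Equiv.sigmaEquivProd (SiteY i) κ))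
          ((Pi.basis fun _ : SiteY i => b).reindex (Equiv.sigmaEquivProd (SiteY i) κ)) (deltaPrimeAY i (parSymY i) (prodCfg U₀ η a)))
      (fun p : SiteY i × κ => ℓ' p.1) Rc ρ
      (cb * (((d : ℝ) + 1) *
          (K₀ * Real.exp (|η| * Rc) * (K₀ * Real.exp (|η| * Rc) * cl * (K₀ * Real.exp (|η| * Rc)) + cl) * (K₀ * Real.exp (|η| * Rc)) +
            (K₀ * Real.exp (|η| * Rc) * cl * (K₀ * Real.exp (|η| * Rc)) + cl)) +
          Cavg * ((K₀ * Real.exp (|η| * Rc)) ^ D * cl * (K₀ * Real.exp (|η| * Rc)) ^ D)) * Real.exp (ρ * s)) := by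
  -- adapted from `B13OpsYPencilGreenPrime.rawEntryLetters_toMatrix_deltaPrimeAY_prodCfg` (n10-w2), `parSY` ↦ `parSymY`
  set φ : κ → 𝔸 →L[ℂ] ℂ := fun k => (b.coord k).mkContinuous cb (fun a => by rw [Basis.coord_apply]; exact hcb a k) with hφ
  have hφapp : ∀ k (a : 𝔸), φ k a = b.coord k a := fun k a => LinearMap.mkContinuous_apply _ _ _ _
  set Kη : ℝ := K₀ * Real.exp (|η| * Rc) with hKη
  have hK0 : 0 ≤ K₀ := zero_le_one.trans hK1
  have hKη0 : 0 ≤ Kη := mul_nonneg hK0 (Real.exp_nonneg _)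
  have eP : ∀ t S : ℝ, ((d : ℝ) + 1) * (Kη * (Kη * t * Kη + t) * Kη + (Kη * t * Kη + t)) + S * (Kη ^ D * t * Kη ^ D) =
      t * (((d : ℝ) + 1) * ((Kη * Kη + 1) * (Kη * Kη + 1))) + S * t * (Kη ^ D * Kη ^ D) := by
    intro t S; ring
  have hA₁ : 0 ≤ ((d : ℝ) + 1) * ((Kη * Kη + 1) * (Kη * Kη + 1)) :=
    mul_nonneg (by positivity) (mul_nonneg (by nlinarith [mul_nonneg hKη0 hKη0]) (by nlinarith [mul_nonneg hKη0 hKη0]))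
  have hA₂ : 0 ≤ Kη ^ D * Kη ^ D := mul_nonneg (pow_nonneg hKη0 _) (pow_nonneg hKη0 _)
  have hM0 : 0 ≤ ((d : ℝ) + 1) * (Kη * (Kη * cl * Kη + cl) * Kη + (Kη * cl * Kη + cl)) + Cavg * (Kη ^ D * cl * Kη ^ D) := by
    rw [eP]
    exact add_nonneg (mul_nonneg hcl0 hA₁) (mul_nonneg (mul_nonneg hCavg0 hcl0) hA₂)
  refine rawEntryLetters_toMatrix_of_coordFamily b (fun a => deltaPrimeAY i (parSymY i) (prodCfg U₀ η a)) ?_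
  refine rawEntryLetters_of_range_family (fun p q => ?_) hρ (mul_nonneg hcb0 hM0) (fun u _ p q hne => ?_) (fun u hu p q => ?_)
  · exact (differentiableOn_coord_deltaPrimeAY_parSymY_prodCfg i U₀ η φ b p.1 q.1 p.2 q.2).congr fun u _ => (hφapp p.2 _).symm
  · refine tdist_le_of_deltaPrimeAY_single_ne_zero i ℓ' hs0 hℓ hℓa (par := parSymY i) (U := prodCfg U₀ η u) (E := b q.2) fun h0 => hne ?_
    rw [h0, map_zero]
  · have hΛ : ‖(Pi.single q.1 (b q.2) : SiteY i → 𝔸)‖ ≤ cl := by rw [Pi.norm_single]; exact hcl q.2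
    have hSz : ∑ w, |avgCoeffY i p.1 w| ≤ Cavg := hCavg p.1
    have h74 := norm_deltaPrimeAY_parSymY_prodCfg_le i U₀ η hU hUi hK1 hRc hD (Pi.single q.1 (b q.2)) hu p.1
    have hmono : ((d : ℝ) + 1) * (Kη * (Kη * ‖(Pi.single q.1 (b q.2) : SiteY i → 𝔸)‖ * Kη + ‖(Pi.single q.1 (b q.2) : SiteY i → 𝔸)‖) * Kη +
          (Kη * ‖(Pi.single q.1 (b q.2) : SiteY i → 𝔸)‖ * Kη + ‖(Pi.single q.1 (b q.2) : SiteY i → 𝔸)‖)) +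
        (∑ w, |avgCoeffY i p.1 w|) * (Kη ^ D * ‖(Pi.single q.1 (b q.2) : SiteY i → 𝔸)‖ * Kη ^ D) ≤
        ((d : ℝ) + 1) * (Kη * (Kη * cl * Kη + cl) * Kη + (Kη * cl * Kη + cl)) + Cavg * (Kη ^ D * cl * Kη ^ D) := by
      rw [eP, eP]
      exact add_le_add (mul_le_mul_of_nonneg_right hΛ hA₁)
        (mul_le_mul_of_nonneg_right (mul_le_mul hSz hΛ (norm_nonneg _) hCavg0) hA₂)
    calc ‖b.coord p.2 (deltaPrimeAY i (parSymY i) (prodCfg U₀ η u) (Pi.single q.1 (b q.2)) p.1)‖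
        ≤ cb * ‖deltaPrimeAY i (parSymY i) (prodCfg U₀ η u) (Pi.single q.1 (b q.2)) p.1‖ := by
          rw [Basis.coord_apply]; exact hcb _ _
      _ ≤ cb * (((d : ℝ) + 1) * (Kη * (Kη * cl * Kη + cl) * Kη + (Kη * cl * Kη + cl)) + Cavg * (Kη ^ D * cl * Kη ^ D)) :=
          mul_le_mul_of_nonneg_left (h74.trans hmono) hcb0

end Packaging

/-! ## §5. ★★★ The G′-junction at `parSymY`, modulo the two centre inputs -/

section GreenPrime

variable [NormOneClass 𝔸] [DecidableEq (SiteY i)]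
variable {ν : ℕ} {Nf : Fin ν → ℕ} [∀ j, NeZero (Nf j)]
variable {κ : Type} [Fintype κ] [DecidableEq κ] (b : Basis κ ℂ 𝔸)
variable {D : ℕ}

/-- ★★★ **THE G′-JUNCTION AT THE v4 LETTER** (GreenPrime §4 re-keyed at `parSymY`): along pv27's pencil `A′ ↦ e^{iηA′}U₀`, the matrices of
`G′ = GpY i (parSymY i)` in the product basis have the N10 letters `RawEntryLetters (A′ ↦ toMatrix B′ B′ (G′(e^{iηA′}U₀))) (ℓ ∘ fst) R₁⋆ ρ′ (2·cb·cl·B_G)` at the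
located thin radius, for every `0 ≤ ρ′ < ρ`, DISPLAYING: `IsUnit (Δ′_a(U₀))` and the pointwise bound `‖G′(U₀)(δ_x ⊗ E)(y)‖ ≤ B_G‖E‖e^{−ρ d(ℓy,ℓx)}` at the ONE real
background (on the (3.35) class both are N06's THEOREMS — module 79), NODE 00's numerals `K₀ D Cavg s`, the basis numerals, a fibre bound `m`, `0 < Rc`.
[cite: Balaban1985BackgroundPropagators, (3.24)–(3.25) p.394, Thm 3.1 (3.42) p.397, Thm 3.4 p.400, (3.60)–(3.65) p.402, Thm 3.10 (3.107)–(3.108) p.416;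
Balaban1988RG2Cluster, (2.5)–(2.7) pp.12–13, p.15; Balaban1984PropagatorsII, Lemma 2.1 (2.61) p.234] -/
theorem rawEntryLetters_toMatrix_GpY_parSymY_prodCfg_of_pencil
    (hU : ∀ μ x, ‖(U₀ μ x : 𝔸)‖ ≤ K₀) (hUi : ∀ μ x, ‖(((U₀ μ x)⁻¹ : 𝔸ˣ) : 𝔸)‖ ≤ K₀) (hK1 : 1 ≤ K₀) (hRc : 0 < Rc)
    (hD : ∀ z w, avgCoeffY i z w ≠ 0 →
      Site.tdist ((boxEquiv i.hN).symm z) ((boxEquiv i.hN).symm (cornerY i (levY i z) z)) +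
        Site.tdist ((boxEquiv i.hN).symm (cornerY i (levY i z) z)) ((boxEquiv i.hN).symm w) ≤ D)
    {Cavg : ℝ} (hCavg0 : 0 ≤ Cavg) (hCavg : ∀ z, ∑ w, |avgCoeffY i z w| ≤ Cavg)
    {cb cl : ℝ} (hcb : ∀ (a : 𝔸) (k : κ), ‖b.repr a k‖ ≤ cb * ‖a‖) (hcb0 : 0 ≤ cb) (hcl : ∀ l, ‖b l‖ ≤ cl) (hcl0 : 0 ≤ cl)
    (ℓ' : SiteY i → UT Nf) {s : ℝ} (hs0 : 0 ≤ s)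
    (hℓ : ∀ μ z, tdist1 Nf (ℓ' (shiftY i μ z)) (ℓ' z) ≤ s) (hℓa : ∀ z w, avgCoeffY i z w ≠ 0 → tdist1 Nf (ℓ' z) (ℓ' w) ≤ s)
    {m : ℕ} (hfib : ∀ y : UT Nf, (univ.filter fun p : SiteY i × κ => ℓ' p.1 = y).card ≤ m)
    (hunit : IsUnit (deltaPrimeAY i (parSymY i) U₀)) {BG ρ : ℝ} (hBG : 0 ≤ BG) (hρ : 0 ≤ ρ)
    (hO : ∀ x y (E : 𝔸), ‖GpY i (parSymY i) U₀ (Pi.single x E) y‖ ≤ BG * ‖E‖ * Real.exp (-(ρ * tdist1 Nf (ℓ' y) (ℓ' x))))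
    {ρ' : ℝ} (hρ'0 : 0 ≤ ρ') (hρ' : ρ' < ρ) :
    RawEntryLetters (fun a : Fin (d + 1) → Site (PV d ℓ i.m i.K hd hL) 0 → 𝔸 =>
        LinearMap.toMatrix ((Pi.basis fun _ : SiteY i => b).reindex (Equiv.sigmaEquivProd (SiteY i) κ))
          ((Pi.basis fun _ : SiteY i => b).reindex (Equiv.sigmaEquivProd (SiteY i) κ)) (GpY i (parSymY i) (prodCfg U₀ η a)))
      (fun p : SiteY i × κ => ℓ' p.1)
      (Rc / (4 * ((cb * (((d : ℝ) + 1) *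
          (K₀ * Real.exp (|η| * Rc) * (K₀ * Real.exp (|η| * Rc) * cl * (K₀ * Real.exp (|η| * Rc)) + cl) * (K₀ * Real.exp (|η| * Rc)) +
            (K₀ * Real.exp (|η| * Rc) * cl * (K₀ * Real.exp (|η| * Rc)) + cl)) +
          Cavg * ((K₀ * Real.exp (|η| * Rc)) ^ D * cl * (K₀ * Real.exp (|η| * Rc)) ^ D)) * Real.exp (ρ * s)) *
          (cb * cl * BG) * (m * B6.c0 1 ((ρ - ρ') / 3) ^ ν) * (m * B6.c0 1 ((ρ - ρ') / 3) ^ ν)) + 1))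
      ρ' (2 * (cb * cl * BG)) := by
  have hA := rawEntryLetters_toMatrix_deltaPrimeAY_parSymY_prodCfg i U₀ η b hU hUi hK1 hRc.le hD hCavg0 hCavg hcb hcb0 hcl hcl0 ℓ' hs0 hℓ hℓa hρ
  have h0 : deltaPrimeAY i (parSymY i) (prodCfg U₀ η 0) * GpY i (parSymY i) U₀ = 1 := by
    rw [prodCfg_zero]
    exact deltaPrimeAY_mul_GpY i (parSymY i) U₀ hunit
  exact rawEntryLetters_toMatrix_ringInverse_located_of_kernelBound b (fun a => deltaPrimeAY i (parSymY i) (prodCfg U₀ η a)) ℓ' hA h0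
    hcb hcb0 hcl hcl0 hBG hO hfib hRc hρ'0 hρ'

end GreenPrime

end Literature.MathematicalPhysics.QuantumFieldTheory.Balaban1983to89.B13OpsYPencilGreenPrimeSym

end
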